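import Summits.Schanuel.Schanuel.Theorems.RootDecomp1KSectorTheorem05

/-!
# RootDecomp1KSectorTheorem — lens 1, generation 67, NODE 27 «THE SECTOR THEOREM BY ONE NEWTON STEP AT (∞,∞) — THE EDGE ENGINE» — FORK (B): the FIRST-ORDER SECTOR THEOREM at FLOOR F (`thinFibreAt_of_sectorCond : c k ≠ 0 → DomZero k c → SectorCond m₀ k c → ThinFibreAt m₀ (xPolyP k c)`, every m₀ / k / monomial support, the only escape the typed residue `Residue m₀ k c`; one PROVED Diophantine input `Ridout.padicRoth_int`; CLAIM L3031, PRICE L3032, ADDENDUM L3037, RULE K-R58, NODE L3047, VERDICT L3050) — continuation (RootDecomp1KSectorTheorem06): §9  TRANSPORT (T) and the `x`-LINEAR COROLLARY (F4 α): every `A(Y) + x·B(Y)`, `deg B ≤ deg A − 2` — 13 declarations `size_regime` … `sum_range_ite_shift`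

(lens-1 g67 NODE 27 «THE SECTOR THEOREM BY ONE NEWTON STEP AT (∞,∞) — THE EDGE ENGINE» L3047: HOME kernel K = HOME/decomp-schanuel-lens-1/g67/lean/SectorTheorem.lean sha256 bbe43d14…, 2869 l, ONE namespace `Summit.Schanuel.Schanuel.Theorems.RootDecomp1KSectorTheorem`, imports the tree port …RootDecomp1KDigitPincer03 ONLY (node 26's record port; its closure holds every cell file used); no private / instance / set_option / notation / sorry / new axiom / binder / `decide` on levels; lens farm rc 0 · 0 errors · 0 sorries · warnings dupNamespace only, `--axioms` standard on the 18 deciding declarations, Probe rc 0 (g67/out/); memo g67/NODE-g67.md; CLAIM L3031 (ASK-FIRST under K-R57 (iii)); crit g12 PRICE L3032 (fork (A) ×0-AS-RECORD as posted / fork (B) a kernel meeting FLOOR F = «FIRST-ORDER SECTOR THEOREM» = THEOREM ×1 consuming K-R57 (iii); CHECKLIST K-g67 F1–F6 + S1–S8; RULE K-R58 PRE-ANNOUNCED) and PRICE ADDENDUM L3037 ((F6′) `W4P` by tree name; the ρ3 specimen `x² + x·Y² + Y⁵ + 3` of writer NOTE 17 L3036 = the F5 exhibit); census instruments LIVENESS-v36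 (key edge) / v37 (key ls2); crit g12 VERDICT L3050 (2026-09-02T03:35Z): THEOREM ×1 GRANTED under K-R57 (iii) for FORK (B) = the FIRST-ORDER SECTOR THEOREM AT FLOOR F (F1 F2 F3 (T) F4(α) F4(β) F5 F6 F6′ R-27-i and CHECKLIST S1–S8 met on the critic's own farm runs), the single ×1 of the sector line CONSUMED (K-R58 (i): no further ×1 on this line), TALLY lens-1 ×22 + THEOREM ×24, RULE K-R58 FIXED (PRICE L3032 (i)–(v) verbatim with the ADDENDUM L3037 gloss; W-27-2 = a ×0 wish for typed stratum predicates), PORT GO → census-1 (this port; PORT IDENTITY 27 owed by the seated critic). Port by census-1 gen 25 as `RootDecomp1KSectorTheorem01–10` (files ≤ 400 lines; `--supports stmt-Schanuel-33364`, the item stays OPEN; no census credit carried; RULE K-R58 (iv): UNCONDITIONAL PART ∪= these names): 01 = K l.1–307 of the prepped source (opens §1 / §2 / §3) — 20 decls `dMax`, `box`, `supp`, …, `two_zpow_inj`; 02 = K l.308–570 of the prepped source (opens §4) — 5 decls `far_pair`, `natDegree_le_dMax`, `norm_pow_sub_one_le`, …, `mem_supp`; 03 = K l.571–896 of the prepped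 source (opens §4b / §5) — 12 decls `layered_bound`, `edge_bound_one`, `edge_bound_crude`, …, `tendsto_partialSum_two`; 04 = K l.897–1221 of the prepped source (opens §6 / §7) — 10 decls `arch_finite`, `ridout_two`, `lt_rpow_neg_of_pow_mul_pow_lt`, …, `factorial_pred_le_div`; 05 = K l.1222–1500 of the prepped source (opens §8) — 4 decls `pair_levels_finite`, `dvd_lc_pow_val`, `den_le_of_dvd`, `den_rescaled_le`; 06 = K l.1501–1822 of the prepped source (opens §9) — 13 decls `size_regime`, `c_zero_ne_zero`, `far_levels_finite`, …, `sum_range_ite_shift`; 07 = K l.1823–2080 of the prepped source (inside §9) — 14 decls `layerPoly_lin2`, `layer0_lin2`, `layer1_lin2`, …, `natDegree_scaleShift`; 08 = K l.2081–2401 of the prepped source (opens §10) — 18 decls `thinFibreAt_xLinear`, `thinFibreAt_xPolyP_one`, `edgeGood_of_gap`, …, `thinFibreAt_M_sector`; 09 = K l.2402–2627 of the prepped source (opens §11) — 17 decls `sectorCond_beta0_example`, `thinFibreAt_beta0_example`, `thinFibreAt_generic_xLinear_example`, …, `rho2_two`; 10 = K l.2628–2905 of the prepped source (opens §12) — 13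 decls `residue_rho2`, `rho3`, `rho3_zero`, …, `W4P_eq`. 39 one-line docstrings synthesised for undocumented helper declarations (statements quoted, census port convention since gen 22); everything else = K VERBATIM (statements, names, proofs, K's module docstring kept in part 01 below this provenance block).)
-/

noncomputable section

namespace Summit.Schanuel.Schanuel.Theorems.RootDecomp1KSectorTheorem

open Polynomial LiouvilleNumber
open scoped Nat
open Summit.Schanuel.Schanuel.Theorems.RootDecomp1KTwoBaseCell (psNumer partialSum_eq_psNumer_div coprime_psNumer)
open Summit.Schanuel.Schanuel.Theorems.RootDecomp1KRelLiouvilleCell (partialSum_two_strictMono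
  abs_liouvilleNumber_two_sub_partialSum)
open Summit.Schanuel.Schanuel.Theorems.RootDecomp1KDegreeLadder
open Summit.Schanuel.Schanuel.Theorems.RootDecomp1KXLinear (xLinP bev_xLinP norm_ratCast_two norm_ratCast_of_le
  norm_psNumer_sub_one)
open Summit.Schanuel.Schanuel.Theorems.RootDecomp1KDigitPincer (xc XP X6P)
open Summit.Schanuel.Schanuel.Theorems.RootDecomp1KOddEmpty (W4P w4C vG natDegree_vG)
open Summit.Schanuel.Schanuel.Theorems.RootDecomp1KHyperellipticSiegel (mQ mC mC_zero mC_one mC_two natDegree_mQ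
  coeff_mQ_five leadingCoeff_mQ)
open Summit.Schanuel.Schanuel.Theorems.RootDecomp1KXLinearII (norm_aeval_le norm_psNumer)
open Summit.Schanuel.Schanuel.Theorems.RootDecomp1KXTop
open Summit.Schanuel.Schanuel.Theorems.RootDecomp1KXAll
open Summit.Schanuel.Schanuel.Theorems.RootDecomp1KLevelFinite
open Summit.Schanuel.Schanuel.Theorems.RootDecomp1KLocalExponent
open Summit.Schanuel.Schanuel.Theorems.RootDecomp1KIntegrality

/-- **THE SIZE REGIME** (super-critical violating slopes are harmless): if `q·E = s·N! + Δ`, `|Δ| ≤ V`,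
`q + 1 ≤ m₀·s` and `E·m₀·N ≤ c' + (N+1)!`, then `N ≤ q + V·m₀ + q·c'`. -/
theorem size_regime {q s m₀ c' V N E : ℕ} {Δ : ℤ} (hΔ : |Δ| ≤ V) (hms : q + 1 ≤ m₀ * s)
    (hE : (q : ℤ) * E = s * (N ! : ℕ) + Δ) (hviol : E * m₀ * N ≤ c' + (N + 1)!) : N ≤ q + V * m₀ + q * c' := by
  by_contra hlt
  push Not at hlt
  have hfac : (N + 1)! = (N + 1) * N ! := Nat.factorial_succ N
  have hNf : N ≤ N ! := Nat.self_le_factorial N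
  -- everything in `ℤ`
  have hviolZ : (q : ℤ) * E * m₀ * N ≤ q * c' + q * ((N + 1) * (N ! : ℕ)) := by
    have h1 : ((E * m₀ * N : ℕ) : ℤ) ≤ ((c' + (N + 1)! : ℕ) : ℤ) := by exact_mod_cast hviol
    rw [hfac] at h1
    push_cast at h1
    have := mul_le_mul_of_nonneg_left h1 (by positivity : (0 : ℤ) ≤ q)
    nlinarith
  have hmsZ : ((q : ℤ) + 1) ≤ (m₀ : ℤ) * s := by exact_mod_cast hms
  have hΔlo : -(V : ℤ) ≤ Δ := by rw [abs_le] at hΔ; exact hΔ.1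
  have hF0 : (0 : ℤ) ≤ (N ! : ℕ) := by positivity
  have hN0 : (0 : ℤ) ≤ N := by positivity
  have hm0 : (0 : ℤ) ≤ m₀ := by positivity
  -- `q·E·m₀·N = (s·N! + Δ)·m₀·N ≥ (q+1)·N!·N − V·m₀·N`
  have h2 : (q : ℤ) * E * m₀ * N = (m₀ * s) * (N ! : ℕ) * N + Δ * m₀ * N := by
    have : (q : ℤ) * E * m₀ * N = ((q : ℤ) * E) * m₀ * N := by ring
    rw [this, hE]; ring
  have h3 : ((q : ℤ) + 1) * ((N ! : ℕ) * N) ≤ (m₀ * s) * (N ! : ℕ) * N := by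
    have := mul_le_mul_of_nonneg_right hmsZ (mul_nonneg hF0 hN0)
    linarith [this]
  have h4 : -(V : ℤ) * (m₀ * N) ≤ Δ * m₀ * N := by
    have := mul_le_mul_of_nonneg_right hΔlo (mul_nonneg hm0 hN0)
    linarith [this]
  -- hence `N!·(N − q) ≤ q·c' + V·m₀·N`
  have h5 : ((N ! : ℕ) : ℤ) * ((N : ℤ) - q) ≤ q * c' + V * (m₀ * N) := by nlinarith
  have hNq : (0 : ℤ) ≤ (N : ℤ) - q := by
    have : q ≤ N := by nlinarith
    have : (q : ℤ) ≤ N := by exact_mod_cast this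
    linarith
  have h6 : (N : ℤ) * ((N : ℤ) - q) ≤ ((N ! : ℕ) : ℤ) * ((N : ℤ) - q) :=
    mul_le_mul_of_nonneg_right (by exact_mod_cast hNf) hNq
  have h7 : (N : ℤ) * ((N : ℤ) - q - V * m₀) ≤ q * c' := by nlinarith
  have h8 : (q : ℤ) * c' + 1 ≤ (N : ℤ) - q - V * m₀ := by
    have : ((q + V * m₀ + q * c' : ℕ) : ℤ) < N := by exact_mod_cast hlt
    push_cast at this
    linarith
  have h9 : (N : ℤ) ≤ (N : ℤ) * ((N : ℤ) - q - V * m₀) := by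
    have := mul_le_mul_of_nonneg_left h8 hN0
    have e : (N : ℤ) * (q * c' + 1) = N * (q * c') + N := by ring
    have : (0 : ℤ) ≤ N * (q * c') := by positivity
    linarith
  have h10 : ((q * c' : ℕ) : ℤ) < N := by
    have : q * c' ≤ q + V * m₀ + q * c' := by omega
    exact_mod_cast lt_of_le_of_lt this hlt
  push_cast at h10
  linarith

/-- under dominance with `c_k ≠ 0`, `c₀ ≠ 0`. -/
theorem c_zero_ne_zero {k : ℕ} {c : ℕ → ℤ[X]} (hB : c k ≠ 0) (hdom : DomZero k c) : c 0 ≠ 0 := by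
  rcases Nat.eq_zero_or_pos k with hk | hk
  · subst hk; exact hB
  · intro h
    have := hdom k hk le_rfl
    rw [h, natDegree_zero] at this
    exact Nat.not_lt_zero _ this

/-- **THE FAR CLAUSE FROM THE SECTOR CONDITION.**  Under dominance, `c_k ≠ 0` and `SectorCond m₀ k c`, beyond the
tie radius `R₀` only finitely many levels `N` carry a level point `r` with `|r| ≤ C` violating
`C·2^{(N+1)!} < den(r)^{m₀N}`: the tie lemma names a violating-or-not hull slope `s/q`; `m₀·s > q` is the size
regime (`size_regime`), `m₀·s ≤ q` is the edge engine (`pair_levels_finite`) on the rescaled point `W = r·2^{s·N!/q}`. -/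
theorem far_levels_finite (k : ℕ) (c : ℕ → ℤ[X]) (hB : c k ≠ 0) (hdom : DomZero k c) {m₀ : ℕ}
    (hS : SectorCond m₀ k c) :
    ∃ (R₀ : ℝ) (N₁ : ℕ), ∀ C : ℝ, {N : ℕ | N₁ ≤ N ∧ ∃ r : ℚ, |(r : ℝ)| ≤ C ∧
      bev (xPolyP k c) (partialSum 2 N) r = 0 ∧ R₀ < ‖(r : PadicAlgCl 2)‖ ∧
      (r.den : ℝ) ^ (m₀ * N) ≤ C * 2 ^ (N + 1)!}.Finite := by
  classical
  have h0 : c 0 ≠ 0 := c_zero_ne_zero hB hdom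
  obtain ⟨R₀, N₁, hR₀1, hpair⟩ := far_pair k c hB
  refine ⟨R₀, N₁, fun C => ?_⟩
  -- abbreviations for a pair `p = (j₁, j₂)`
  set dd : ℕ → ℕ := fun j => (c j).natDegree with hdd
  set vv : ℕ → ℤ := fun j => (padicValInt 2 (c j).leadingCoeff : ℤ) with hvv
  set PAIR : ℕ × ℕ → Set ℕ := fun p => {N : ℕ | N₁ ≤ N ∧ ∃ r : ℚ, |(r : ℝ)| ≤ C ∧
      bev (xPolyP k c) (partialSum 2 N) r = 0 ∧ R₀ < ‖(r : PadicAlgCl 2)‖ ∧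
      (r.den : ℝ) ^ (m₀ * N) ≤ C * 2 ^ (N + 1)! ∧
      (p.1 < p.2 ∧ p.2 ≤ k ∧ c p.1 ≠ 0 ∧ c p.2 ≠ 0 ∧ dd p.2 < dd p.1 ∧
        (((dd p.1 - dd p.2 : ℕ) : ℤ) * (-padicValRat 2 r) = ((p.2 - p.1 : ℕ) : ℤ) * (N ! : ℕ) + (vv p.1 - vv p.2)) ∧
        ∀ j, j ≤ k → c j ≠ 0 → (dd p.1 - dd p.2) * j + (p.2 - p.1) * dd j ≤ (dd p.1 - dd p.2) * p.1 + (p.2 - p.1) * dd p.1)}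
    with hPAIR
  have hcover : {N : ℕ | N₁ ≤ N ∧ ∃ r : ℚ, |(r : ℝ)| ≤ C ∧
      bev (xPolyP k c) (partialSum 2 N) r = 0 ∧ R₀ < ‖(r : PadicAlgCl 2)‖ ∧
      (r.den : ℝ) ^ (m₀ * N) ≤ C * 2 ^ (N + 1)!} ⊆
      ⋃ p ∈ Finset.range (k + 1) ×ˢ Finset.range (k + 1), PAIR p := by
    rintro N ⟨hN, r, hr, hP, hfar, hviol⟩
    obtain ⟨j₁, j₂, hlt, hle, hc1, hc2, hd, heq, hhull⟩ := hpair N hN r hP hfar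
    have hp : (j₁, j₂) ∈ Finset.range (k + 1) ×ˢ Finset.range (k + 1) := by
      rw [Finset.mem_product, Finset.mem_range, Finset.mem_range]; exact ⟨by omega, by omega⟩
    exact Set.mem_biUnion hp ⟨hN, r, hr, hP, hfar, hviol, hlt, hle, hc1, hc2, hd, heq, hhull⟩
  refine Set.Finite.subset (Set.Finite.biUnion (Finset.finite_toSet _) fun p _ => ?_) hcover
  -- finiteness of `PAIR p`
  rcases Set.eq_empty_or_nonempty (PAIR p) with hemp | ⟨N₀, hN₀mem⟩
  · rw [hemp]; exact Set.finite_empty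
  obtain ⟨-, r₀, -, -, -, -, hlt, hle, hc1, hc2, hd, -, hhull⟩ := hN₀mem
  obtain ⟨j₁, j₂⟩ := p
  simp only at hlt hle hc1 hc2 hd hhull
  set q : ℕ := dd j₁ - dd j₂ with hqdef
  set s : ℕ := j₂ - j₁ with hsdef
  have hq : 0 < q := by simp only [hqdef]; omega
  have hs : 0 < s := by simp only [hsdef]; omega
  set Δ : ℤ := vv j₁ - vv j₂ with hΔdef
  obtain ⟨V, hV⟩ : ∃ V : ℕ, |Δ| ≤ V := ⟨(|Δ|).toNat, by rw [Int.toNat_of_nonneg (abs_nonneg Δ)]⟩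
  -- a dyadic bound for `C`
  obtain ⟨c', hc'⟩ : ∃ c' : ℕ, C ≤ (2 : ℝ) ^ c' := by
    obtain ⟨c', hc'⟩ := exists_nat_ge C
    exact ⟨c', hc'.trans (by exact_mod_cast (Nat.lt_two_pow_self).le)⟩
  by_cases hsize : q < m₀ * s
  · -- THE SIZE REGIME
    refine (Set.finite_le_nat (q + V * m₀ + q * c')).subset ?_
    rintro N ⟨hN, r, hr, hP, hfar, hviol, -, -, -, -, -, heq, -⟩
    rw [Set.mem_setOf_eq]
    have hrpos : 0 < ‖(r : PadicAlgCl 2)‖ := lt_of_lt_of_le (lt_of_lt_of_le one_pos hR₀1) hfar.le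
    have hr0 : r ≠ 0 := by
      intro h; rw [h, Rat.cast_zero, norm_zero] at hrpos; exact lt_irrefl _ hrpos
    set E : ℤ := -padicValRat 2 r with hEdef
    have hρ : ‖(r : PadicAlgCl 2)‖ = (2 : ℝ) ^ E := norm_ratCast_two hr0
    have hE0 : 0 ≤ E := by
      have h : (2 : ℝ) ^ (0 : ℤ) < (2 : ℝ) ^ E := by
        rw [zpow_zero, ← hρ]; exact lt_of_le_of_lt hR₀1 hfar
      exact (two_zpow_lt_iff.mp h).le
    obtain ⟨E', hE'⟩ := Int.eq_ofNat_of_zero_le hE0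
    -- `2^{E'} ≤ den r`, hence `2^{E' m₀ N} ≤ den^{m₀ N} ≤ C 2^{(N+1)!} ≤ 2^{c' + (N+1)!}`
    have hden : (2 : ℝ) ^ E' ≤ r.den := by
      have := norm_ratCast_le_den r
      rw [hρ, hE', zpow_natCast] at this
      exact this
    have h1 : (2 : ℝ) ^ (E' * (m₀ * N)) ≤ (2 : ℝ) ^ (c' + (N + 1)!) := by
      rw [pow_mul, pow_add]
      calc ((2 : ℝ) ^ E') ^ (m₀ * N) ≤ (r.den : ℝ) ^ (m₀ * N) := pow_le_pow_left₀ (by positivity) hden _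
        _ ≤ C * 2 ^ (N + 1)! := hviol
        _ ≤ 2 ^ c' * 2 ^ (N + 1)! := mul_le_mul_of_nonneg_right hc' (by positivity)
    have h2 : E' * (m₀ * N) ≤ c' + (N + 1)! := (pow_le_pow_iff_right₀ (by norm_num : (1 : ℝ) < 2)).mp h1
    have heq' : (q : ℤ) * (E' : ℤ) = s * (N ! : ℕ) + Δ := by
      have := heq
      rw [hE'] at this
      simpa [hqdef, hsdef, hΔdef] using this
    exact size_regime hV (by omega) heq' (by rw [← mul_assoc] at h2; exact h2)
  · -- THE EDGE ENGINE on the rescaled point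
    push Not at hsize
    have hgood : EdgeGood k c s q := hS j₁ j₂ hlt hle hc1 hc2 hd hsize hhull
    set RW : ℝ := (2 : ℝ) ^ V with hRW
    set Dn : ℕ := ⌈max 1 RW * |((c 0).leadingCoeff : ℝ)|⌉₊ with hDn
    have hfin := pair_levels_finite k c hB hs hq hgood (Rlo := RW⁻¹) (by positivity) RW C Dn
    refine ((Set.finite_lt_nat (4 * q + 3)).union hfin).subset ?_
    rintro N ⟨hN, r, hr, hP, hfar, hviol, -, -, -, -, -, heq, -⟩
    by_cases hsmall : N < 4 * q + 3
    · exact Or.inl hsmall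
    right
    push Not at hsmall
    have hN3 : 3 ≤ N := by omega
    have hN4 : 4 * q ≤ N := by omega
    have hqN : q ≤ N := by omega
    set n : ℕ := N ! / q with hndef
    have hn : N ! = q * n := (Nat.mul_div_cancel' (Nat.dvd_factorial hq hqN)).symm
    have hrpos : 0 < ‖(r : PadicAlgCl 2)‖ := lt_of_lt_of_le (lt_of_lt_of_le one_pos hR₀1) hfar.le
    have hr0 : r ≠ 0 := by
      intro h; rw [h, Rat.cast_zero, norm_zero] at hrpos; exact lt_irrefl _ hrpos
    set E : ℤ := -padicValRat 2 r with hEdef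
    have hρ : ‖(r : PadicAlgCl 2)‖ = (2 : ℝ) ^ E := norm_ratCast_two hr0
    set W : ℚ := r * 2 ^ (s * n) with hWdef
    have hW0 : W ≠ 0 := mul_ne_zero hr0 (pow_ne_zero _ two_ne_zero)
    -- `‖W‖₂ = 2^{E − s n} ≤ 2^V`
    have heq' : (q : ℤ) * E = s * (N ! : ℕ) + Δ := by
      simpa [hqdef, hsdef, hΔdef] using heq
    have hEsn : |E - (s * n : ℕ)| ≤ V := by
      have h1 : (q : ℤ) * (E - (s * n : ℕ)) = Δ := by
        rw [mul_sub, heq', hn]; push_cast; ring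
      have h2 : |E - (s * n : ℕ)| ≤ |Δ| := by
        rw [← h1, abs_mul, Nat.abs_cast]
        exact le_mul_of_one_le_left (abs_nonneg _) (by exact_mod_cast hq)
      exact h2.trans hV
    have hWval : ‖(W : PadicAlgCl 2)‖ = (2 : ℝ) ^ (E - (s * n : ℕ)) := by
      have h1 : (W : PadicAlgCl 2) = (r : PadicAlgCl 2) * 2 ^ (s * n) := by rw [hWdef]; push_cast; ring
      rw [h1, norm_mul, hρ, norm_two_pow_zpow, ← zpow_add₀ (by norm_num : (2 : ℝ) ≠ 0), sub_eq_add_neg]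
    have hWnorm : ‖(W : PadicAlgCl 2)‖ ≤ RW := by
      rw [hWval, hRW, ← zpow_natCast]
      exact two_zpow_le_iff.mpr ((le_abs_self _).trans hEsn)
    have hWlo : RW⁻¹ ≤ ‖(W : PadicAlgCl 2)‖ := by
      rw [hWval, hRW, ← zpow_natCast, ← zpow_neg]
      exact two_zpow_le_iff.mpr (by have := neg_abs_le (E - (s * n : ℕ)); omega)
    have hWden : W.den ≤ Dn := by
      have h1 := den_rescaled_le k c hdom h0 hP hWdef hWnorm
      have h2 : (W.den : ℝ) ≤ Dn := h1.trans (Nat.le_ceil _)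
      exact_mod_cast h2
    have hWabs : |(W : ℝ)| ≤ C * 2 ^ (s * n) := by
      rw [hWdef]; push_cast
      rw [abs_mul, abs_of_pos (by positivity : (0 : ℝ) < 2 ^ (s * n))]
      exact mul_le_mul_of_nonneg_right hr (by positivity)
    exact ⟨hN3, hN4, r, W, hW0, rfl, hP, hWlo, hWnorm, hWden, hWabs⟩

/-- **THE SECTOR THEOREM (lens 1, NODE 27).**  For every presentation `P = Σ_{j ≤ k} c_j(Y)·x^j` with `c_k ≠ 0`
and DOMINANT `c₀` (`deg c_j < deg c₀` for `1 ≤ j ≤ k` — the constant-top dominant sector of record, any `x`-degree,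
any number of monomials) satisfying the SECTOR CONDITION at quality `m₀` (every violating hull slope good after ONE
Newton step), `ThinFibreAt m₀ P` holds — HYPOTHESIS-FREE (Ridout is the tree's proved theorem; no binder). -/
theorem thinFibreAt_of_sectorCond (k : ℕ) (c : ℕ → ℤ[X]) (hB : c k ≠ 0) (hdom : DomZero k c) {m₀ : ℕ}
    (hS : SectorCond m₀ k c) : ThinFibreAt m₀ (xPolyP k c) := by
  classical
  have h0 : c 0 ≠ 0 := c_zero_ne_zero hB hdom
  obtain ⟨R₀, N₁, hfar⟩ := far_levels_finite k c hB hdom hS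
  intro C
  set D : ℝ := max 1 R₀ * |((c 0).leadingCoeff : ℝ)| with hDdef
  obtain ⟨N₃, hN₃⟩ := (levels_finite_of_bounded (xPolyP k c) C D).bddAbove
  obtain ⟨N₄, hN₄⟩ := (hfar C).bddAbove
  refine ⟨N₁ + N₃ + N₄ + 1, fun N hN r hr hP hnd => ?_⟩
  by_contra hviol
  push Not at hviol
  by_cases hrR : ‖(r : PadicAlgCl 2)‖ ≤ R₀
  · have hden : (r.den : ℝ) ≤ D := den_le_of_level k c hdom h0 hP hrR
    have hmem : N ∈ ⋃ r ∈ {r : ℚ | |(r : ℝ)| ≤ C ∧ (r.den : ℝ) ≤ D},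
        {N : ℕ | bev (xPolyP k c) (partialSum 2 N) r = 0 ∧ ∃ x : ℝ, bev (xPolyP k c) x r ≠ 0} :=
      Set.mem_biUnion (x := r) ⟨hr, hden⟩ ⟨hP, hnd⟩
    have := hN₃ hmem
    omega
  · push Not at hrR
    have hmem : N ∈ {N : ℕ | N₁ ≤ N ∧ ∃ r : ℚ, |(r : ℝ)| ≤ C ∧
        bev (xPolyP k c) (partialSum 2 N) r = 0 ∧ R₀ < ‖(r : PadicAlgCl 2)‖ ∧
        (r.den : ℝ) ^ (m₀ * N) ≤ C * 2 ^ (N + 1)!} := ⟨by omega, r, hr, hP, hrR, hviol⟩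
    have := hN₄ hmem
    omega

/-- **the typed residue is the only escape**: `¬ Residue m₀ k c → ThinFibreAt m₀ (xPolyP k c)` on the sector. -/
theorem thinFibreAt_of_not_residue (k : ℕ) (c : ℕ → ℤ[X]) (hB : c k ≠ 0) (hdom : DomZero k c) {m₀ : ℕ}
    (h : ¬ Residue m₀ k c) : ThinFibreAt m₀ (xPolyP k c) :=
  thinFibreAt_of_sectorCond k c hB hdom (not_not.mp h)

/-! ## §9  TRANSPORT (T) and the `x`-LINEAR COROLLARY (F4 α): every `A(Y) + x·B(Y)`, `deg B ≤ deg A − 2` -/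

/-- **TRANSPORT (T)** (Tschirnhaus–scaling `Y ↦ (Y + a)/b`, `a ∈ ℤ`, `b ≥ 1`): if `Q(x, b·y − a) = b^d · P(x, y)`
identically, then `ThinFibreAt m₀ Q → ThinFibreAt m₀ P` — the level point `r` of `P` goes to the level point
`r' = b·r − a` of `Q` with `den r' ∣ den r`, `|r'| ≤ b·C + |a|`, non-degeneracy preserved. -/
theorem thinFibreAt_of_transport {P Q : ℤ[X][X]} {a : ℤ} {b d : ℕ} (hb : 1 ≤ b)
    (hPQ : ∀ x y : ℝ, bev Q x (b * y - a) = (b : ℝ) ^ d * bev P x y) {m₀ : ℕ}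
    (hQ : ThinFibreAt m₀ Q) : ThinFibreAt m₀ P := by
  intro C
  obtain ⟨N₀, hN₀⟩ := hQ (b * C + |(a : ℝ)|)
  refine ⟨N₀, fun N hN r hr hP hnd => ?_⟩
  have hC0 : 0 ≤ C := (abs_nonneg _).trans hr
  set r' : ℚ := ((b : ℤ) : ℚ) * r + ((-a : ℤ) : ℚ) with hr'
  have hr'cast : (r' : ℝ) = (b : ℝ) * (r : ℝ) - (a : ℝ) := by rw [hr']; push_cast; ring
  have h1 : |(r' : ℝ)| ≤ b * C + |(a : ℝ)| := by
    rw [hr'cast]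
    calc |(b : ℝ) * r - a| ≤ |(b : ℝ) * r| + |(a : ℝ)| := abs_sub _ _
      _ = (b : ℝ) * |(r : ℝ)| + |(a : ℝ)| := by rw [abs_mul, Nat.abs_cast]
      _ ≤ b * C + |(a : ℝ)| := by gcongr
  have h2 : bev Q (partialSum 2 N) r' = 0 := by rw [hr'cast, hPQ, hP, mul_zero]
  have h3 : ∃ x, bev Q x r' ≠ 0 := by
    obtain ⟨x, hx⟩ := hnd
    exact ⟨x, by rw [hr'cast, hPQ]; exact mul_ne_zero (pow_ne_zero _ (by positivity)) hx⟩
  have h4 := hN₀ N hN r' h1 h2 h3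
  have hden : r'.den ≤ r.den := by
    have hd1 : (((b : ℤ) : ℚ) * r).den ∣ r.den := by
      have := Rat.mul_den_dvd ((b : ℤ) : ℚ) r
      rwa [Rat.den_intCast, one_mul] at this
    have hd2 : r'.den ∣ (((b : ℤ) : ℚ) * r).den * (((-a : ℤ) : ℚ)).den := Rat.add_den_dvd _ _
    rw [Rat.den_intCast, mul_one] at hd2
    exact Nat.le_of_dvd r.den_pos (hd2.trans hd1)
  calc C * 2 ^ (N + 1)! ≤ (b * C + |(a : ℝ)|) * 2 ^ (N + 1)! := by
        apply mul_le_mul_of_nonneg_right _ (by positivity)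
        have : C ≤ b * C := le_mul_of_one_le_left hC0 (by exact_mod_cast hb)
        linarith [abs_nonneg (a : ℝ)]
    _ < (r'.den : ℝ) ^ (m₀ * N) := h4
    _ ≤ (r.den : ℝ) ^ (m₀ * N) := pow_le_pow_left₀ (by positivity) (by exact_mod_cast hden) _

/-- the coefficient vector `(A, B, 0, 0, …)`: `xPolyP 1 (lin2 A B) = xLinP A B = A(Y) + x·B(Y)`. -/
def lin2 (A B : ℤ[X]) (j : ℕ) : ℤ[X] := if j = 0 then A else if j = 1 then B else 0

/-- `(A B : ℤ[X]) : lin2 A B 0 = A`. -/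
@[simp] theorem lin2_zero (A B : ℤ[X]) : lin2 A B 0 = A := by simp [lin2]

/-- `(A B : ℤ[X]) : lin2 A B 1 = B`. -/
@[simp] theorem lin2_one (A B : ℤ[X]) : lin2 A B 1 = B := by simp [lin2]

/-- `(A B : ℤ[X]) : xPolyP 1 (lin2 A B) = xLinP A B`. -/
theorem xPolyP_lin2 (A B : ℤ[X]) : xPolyP 1 (lin2 A B) = xLinP A B := by
  rw [xPolyP_one, lin2_zero, lin2_one]

/-- `{k : ℕ} {c : ℕ → ℤ[X]} {p : ℕ × ℕ} (hj : p.1 ≤ k) (hc : (c p.1).coeff p.2 ≠ 0) : p ∈ supp k c`. -/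
theorem mem_supp_of {k : ℕ} {c : ℕ → ℤ[X]} {p : ℕ × ℕ} (hj : p.1 ≤ k) (hc : (c p.1).coeff p.2 ≠ 0) :
    p ∈ supp k c := by
  unfold supp box
  rw [Finset.mem_filter, Finset.mem_product, Finset.mem_range, Finset.mem_range]
  exact ⟨⟨by omega, Nat.lt_succ_of_le ((le_natDegree_of_ne_zero hc).trans (natDegree_le_dMax c hj))⟩, hc⟩

/-- INSPECTION TOOL: the layer polynomials computed on ANY finite exponent set `S` containing the support. -/
theorem layerPoly_eq_sum (k : ℕ) (c : ℕ → ℤ[X]) (S : Finset (ℕ × ℕ)) (hS : ∀ p ∈ S, p.1 ≤ k)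
    (hsupp : ∀ p : ℕ × ℕ, p.1 ≤ k → (c p.1).coeff p.2 ≠ 0 → p ∈ S) (s q M g : ℕ) :
    layerPoly k c s q M g =
      ∑ p ∈ S.filter (fun p => q * p.1 + s * p.2 + g = M), C ((c p.1).coeff p.2) * X ^ p.2 := by
  classical
  unfold layerPoly
  apply Finset.sum_subset
  · intro p hp
    rw [Finset.mem_filter] at hp ⊢
    exact ⟨hsupp p (mem_supp hp.1).1 (mem_supp hp.1).2.2, hp.2⟩
  · intro p hpS hpn
    rw [Finset.mem_filter] at hpS
    have hc : (c p.1).coeff p.2 = 0 := by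
      by_contra hc
      exact hpn (Finset.mem_filter.mpr ⟨mem_supp_of (hS p hpS.1) hc, hpS.2⟩)
    rw [hc, Polynomial.C_0, zero_mul]

/-- `{n t M : ℕ} (F : ℕ → ℤ[X]) (hM : M ≤ n + t) : (∑ i ∈ Finset.range (n + 1), if i + t = M then F i else 0) = if t ≤ M then F (M - t) else 0`. -/
theorem sum_range_ite_shift {n t M : ℕ} (F : ℕ → ℤ[X]) (hM : M ≤ n + t) :
    (∑ i ∈ Finset.range (n + 1), if i + t = M then F i else 0) = if t ≤ M then F (M - t) else 0 := by
  by_cases ht : t ≤ M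
  · rw [if_pos ht, Finset.sum_eq_single (M - t)]
    · rw [if_pos (by omega)]
    · intro i _ hi
      rw [if_neg (by omega)]
    · intro hnot
      rw [Finset.mem_range] at hnot
      exact absurd (by omega : M - t < n + 1) hnot
  · rw [if_neg ht]
    exact Finset.sum_eq_zero fun i _ => if_neg (by omega)

end Summit.Schanuel.Schanuel.Theorems.RootDecomp1KSectorTheorem
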